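import Mathlib
import HarnessLib
import Summits.Langlands.Statement
import Summits.Langlands.Langlands.Theses.DepthPrimeSplit
import Summits.Langlands.Langlands.Theses.WeightMultiplicitySplit
import Summits.Langlands.Langlands.Theorems.WeightMultiplicitySplitMinusculeHodgeType
import Literature.NumberTheory.GaloisRepresentations.LabelledHodgeTateWeights
import Literature.NumberTheory.PAdicHodge.FontaineDpst
import Literature.NumberTheory.GaloisRepresentations.LabelledWeightsDeRhamRank
import Summits.Langlands.Langlands.Theses.ClassicalityWeightSplit
set_option linter.dupNamespace false
set_option linter.unusedVariables false

/-!
# Birth skeleton (BC3) for crux `ClassicalityWeightSplit.WallClassicality` — line `birth` (AFTER-BIRTH form: the route decl BY NAME)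

Route `ClassicalityWeightSplit` (decomp-langlands lens-2 g17; child route at `DepthPrimeSplit.Classicality` stmt-Langlands-25026).  The crux is
the WALL chamber of CLASS (every labelled Hodge–Tate multiplicity ≤ 2, some = 2): cut by RANK and, at rank 2, by PARITY (`ρ.IsOdd`: `det ρ(c) = -1` at every real place) into the weight-one sector proper (n = 2, odd), the Maass-type hard core (n = 2, non-odd) and rank ≥ 3; rank ≤ 1 is EMPTY (kernel: the tree's `card = n`).

Shape (for `ledger skeleton check` / `#h21_check_skeleton`): stubs `theorem stub_<name> : <signature> := by sorry` (each a layer-2 SUB-BOX of the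
cell: the cell's text VERBATIM with ONE rank clause after `0 < n →` — and, for the degenerate cell at rank ≥ 3, the isotypic sub-dial — so no stub
restates the cell, the target CLASS or the summit: probes B6 of the node kit), `namespace _Goal` with `def stub_<name> : Prop := type_of% @stub_<name>`
naming each statement, and the kernel-checked composition `WallClassicality_of (h₁ : _Goal.stub_…) … : <the crux BY NAME>` (seam =
`omega` on the rank; the rank ≤ 1 chamber is discharged INSIDE the composition by the rank bound — it is empty — and rank 2 splits by excluded middle on PARITY `ρ.IsOdd`).  `lean check --json`: rc 0, sorries = the stubs (2 or 3), none elsewhere.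
After birth this AFTER-BIRTH form (route decl BY NAME via `import Summits.Langlands.Langlands.Theses.ClassicalityWeightSplit`) is published with
`ledger crux write <item> Lines/birth.lean --file <this file>` + `ledger skeleton check $(ledger crux dir <item>)/Lines/birth.lean --crux <item>`.
-/

namespace Summit.Langlands.Langlands.Cruxes.WallClassicality.Birth

open scoped NumberField
open Filter IsDedekindDomain Literature.NumberTheory.GaloisRepresentations
open Summit.Langlands.Langlands.Theorems.WeightMultiplicitySplitMinusculeHodgeType (HodgeTateMultLE IsWallHT)

-- the crux BY NAME: `Summit.Langlands.Langlands.Theses.ClassicalityWeightSplit.WallClassicality` (the born route file).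

/-- RANK BOUND (tree theorem `FramedGaloisRep.card_labelledHodgeTateWeightsAt_eq_of_isDeRhamFramed`: de Rham for the pinned datum ⟹ exactly `n`
labelled weights at every label): every labelled multiplicity of a rank-`n` `ρ` de Rham above `ℓ` is `≤ k` whenever `n ≤ k`. -/
theorem hodgeTateMultLE_of_rank_le {K : Type} [Field K] [NumberField K] {n ℓ : ℕ} [Fact ℓ.Prime]
    {ρ : FramedGaloisRep K (PadicAlgCl ℓ) n}
    (hdR : ∀ (v : HeightOneSpectrum (𝓞 K)) (hv : ((ℓ : ℕ) : 𝓞 K) ∈ v.asIdeal),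
      (Literature.NumberTheory.PAdicHodge.fontainePstAdicCompletion v ℓ hv).IsDeRhamFramed (ρ.toLocal v))
    {k : ℕ} (hk : n ≤ k) : HodgeTateMultLE k ρ :=
  fun v hv τ hτ w =>
    ((Multiset.count_le_card w _).trans (FramedGaloisRep.card_labelledHodgeTateWeightsAt_eq_of_isDeRhamFramed ρ v hv (hdR v hv) τ hτ).le).trans hk

/-- stub · `stub_wallRankTwoOdd` — CW at rank 2, ODD = THE WEIGHT-ONE SECTOR proper (labelled weights `{a,a}` at some labelled place above ℓ; totally odd — vacuous for totally complex K): a pro-automorphic irreducible pinned-geometric odd `ρ : Γ_K → GL₂(ℚ̄_ℓ)` with a repeated labelled weight is weakly automorphic.  Why plausibly true: over `K = ℚ` Pan 2022 Thm 1.0.4 [arXiv:2008.07099 p.5: 𝕋(K^p)-pro-modular + irreducible + HT (0,0) ⟹ classical weight one, ANY ℓ, no residual / Taylor–Wiles hypothesis] closes it whenever the approximants can be taken in completed cohomology (dictionary I-g17.1: Satake-pro-automorphic with COHOMOLOGICAL-or-holomorphic approximants ⟹ 𝕋(K^p)-pro-modular, via Carayol + wild-inertia rigidity + Chebotarev/Brauer–Nesbitt),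 and Thm 1.0.5 / Buzzard–Taylor / Pilloni–Stroh close it outright (no pro-automorphy used) for ℓ > 2 under the residual hypotheses; totally real K: Kassaei, Sasaki, Pilloni–Stroh (Hilbert weight one / partial weight one), Jiang 2026 (T-regular) arXiv:2605.18426.  Honest residue: approximants that are algebraic MAASS forms to every depth (the host's PRO does not pin the archimedean type; without Galois representations for Maass forms parity cannot exclude them), ℓ = 2 / residually degenerate over ℚ outside 1.0.4's reach only through that residue, and totally complex K (Bianchi weight one: no Shimura variety).  Size: L over ℚ modulo the dictionary, XL in general.  The BC5 plan-only rung of the route. -/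
theorem stub_wallRankTwoOdd :
    ∀ (K : Type) [Field K] [NumberField K] (n : ℕ) (hcpt : Literature.NumberTheory.Automorphic.isCompact_glFiniteIntegralLevel n K), 0 < n → n = 2 → ∀ (ℓ : ℕ) [Fact ℓ.Prime] (ι : PadicAlgCl ℓ ≃+* ℂ) (ρ : Literature.NumberTheory.GaloisRepresentations.FramedGaloisRep K (PadicAlgCl ℓ) n), ρ.toGaloisRep.IsIrreducible → ((∀ᶠ v : IsDedekindDomain.HeightOneSpectrum (NumberField.RingOfIntegers K) in cofinite, ρ.IsUnramifiedAt v) ∧ ∀ (v : IsDedekindDomain.HeightOneSpectrum (NumberField.RingOfIntegers K)) (hv : ((ℓ : ℕ) : NumberField.RingOfIntegers K) ∈ v.asIdeal), (Literature.NumberTheory.PAdicHodge.fontainePstAdicCompletion v ℓ hv).IsDeRhamFramed (ρ.toLocal v)) → Summit.Langlands.Langlands.Theorems.WeightMultiplicitySplitMinusculeHodgeType.IsWallHT ρ → ρ.IsOdd → (∃ S : Set (IsDedekindDomain.HeightOneSpectrum (NumberField.RingOfIntegers K)), S.Finite ∧ ∀ r : NNReal, 0 < r → ∃ π : Literature.NumberTheory.Automorphic.CuspidalAutomorphicRepData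 n K hcpt, π.1.IsLAlgebraic ∧ ∀ v : IsDedekindDomain.HeightOneSpectrum (NumberField.RingOfIntegers K), v ∉ S → (∃ α : Multiset ℂ, π.1.HasSatakeParamAt v α ∧ ∀ 𝔓 ∈ v.primesAbove, ∀ σ : Field.absoluteGaloisGroup K, IsArithFrobAt (NumberField.RingOfIntegers K) σ 𝔓 → ∀ i : ℕ, Valued.v ((Literature.NumberTheory.GaloisRepresentations.FramedRep.charpoly ρ σ - Literature.NumberTheory.Automorphic.arithFrobPolyOfSatake ι v.residueCard 1 α).coeff i) < r)) → ∃ π : Literature.NumberTheory.Automorphic.CuspidalAutomorphicRepData n K hcpt, π.1.IsLAlgebraic ∧ ∀ᶠ v : IsDedekindDomain.HeightOneSpectrum (NumberField.RingOfIntegers K) in cofinite, SatakeFrobCompatibleAt ι π.1 ρ v := by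
  sorry

/-- stub · `stub_wallRankTwoNonOdd` — CW at rank 2, NON-ODD (`det ρ(c) = +1` at some real place): the avatar must be a MAASS-type form at that place — even Artin-type weight (0,0) (de Rham with equal weights ⟹ potentially unramified at ℓ).  Why plausibly true: implied by reciprocity (Langlands–Tunnell in the solvable-image case; the icosahedral even case is the cell's hard core HC1: `EvenIcosahedralStrongArtin` stmt-2903, `EvenIcosahedralCM` 14074–14078).  Why it might fail / why no engine: every p-adic classicality mechanism (overconvergent-to-classical, Pan's locally analytic completed cohomology) outputs HOLOMORPHIC limits, i.e. odd ρ; a Maass eigenform is not a p-adic limit object of any known kind.  A BARRIER leaf inside the attacked cell (NonRegularWeightBarrier + the archimedean wall).  Size: open problem. -/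
theorem stub_wallRankTwoNonOdd :
    ∀ (K : Type) [Field K] [NumberField K] (n : ℕ) (hcpt : Literature.NumberTheory.Automorphic.isCompact_glFiniteIntegralLevel n K), 0 < n → n = 2 → ∀ (ℓ : ℕ) [Fact ℓ.Prime] (ι : PadicAlgCl ℓ ≃+* ℂ) (ρ : Literature.NumberTheory.GaloisRepresentations.FramedGaloisRep K (PadicAlgCl ℓ) n), ρ.toGaloisRep.IsIrreducible → ((∀ᶠ v : IsDedekindDomain.HeightOneSpectrum (NumberField.RingOfIntegers K) in cofinite, ρ.IsUnramifiedAt v) ∧ ∀ (v : IsDedekindDomain.HeightOneSpectrum (NumberField.RingOfIntegers K)) (hv : ((ℓ : ℕ) : NumberField.RingOfIntegers K) ∈ v.asIdeal), (Literature.NumberTheory.PAdicHodge.fontainePstAdicCompletion v ℓ hv).IsDeRhamFramed (ρ.toLocal v)) → Summit.Langlands.Langlands.Theorems.WeightMultiplicitySplitMinusculeHodgeType.IsWallHT ρ → ¬ ρ.IsOdd → (∃ S : Set (IsDedekindDomain.HeightOneSpectrum (NumberField.RingOfIntegers K)), S.Finite ∧ ∀ r : NNReal, 0 < r → ∃ π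 : Literature.NumberTheory.Automorphic.CuspidalAutomorphicRepData n K hcpt, π.1.IsLAlgebraic ∧ ∀ v : IsDedekindDomain.HeightOneSpectrum (NumberField.RingOfIntegers K), v ∉ S → (∃ α : Multiset ℂ, π.1.HasSatakeParamAt v α ∧ ∀ 𝔓 ∈ v.primesAbove, ∀ σ : Field.absoluteGaloisGroup K, IsArithFrobAt (NumberField.RingOfIntegers K) σ 𝔓 → ∀ i : ℕ, Valued.v ((Literature.NumberTheory.GaloisRepresentations.FramedRep.charpoly ρ σ - Literature.NumberTheory.Automorphic.arithFrobPolyOfSatake ι v.residueCard 1 α).coeff i) < r)) → ∃ π : Literature.NumberTheory.Automorphic.CuspidalAutomorphicRepData n K hcpt, π.1.IsLAlgebraic ∧ ∀ᶠ v : IsDedekindDomain.HeightOneSpectrum (NumberField.RingOfIntegers K) in cofinite, SatakeFrobCompatibleAt ι π.1 ρ v := by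
  sorry

/-- stub · `stub_wallRankGeThree` — CW at rank ≥ 3 (abelian-surface type `{0,0,1,1}` on GSp₄ ⊂ GL₄: Boxer–Calegari–Gee–Pilloni II arXiv:2502.20645 higher Coleman theory / classicality in irregular weight (2,2); Picard type `{0,0,1}` on U(2,1); U(a,b) wall weights; partial weight one in rank ≥ 3).  Why plausibly true: every catalogued engine for p-adic-limit classicality off the regular range lives in multiplicity ≤ 2 (coherent cohomology in singular weight exists exactly there); pro-automorphy supplies the overconvergent / higher-Coleman class, the wall hypothesis bounds the defect by 1 per label.  Why it might fail: non-polarisable ρ over non-CM K has no Shimura realisation at all; non-odd-type signs at real places again force non-holomorphic avatars.  Size: XL. -/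
theorem stub_wallRankGeThree :
    ∀ (K : Type) [Field K] [NumberField K] (n : ℕ) (hcpt : Literature.NumberTheory.Automorphic.isCompact_glFiniteIntegralLevel n K), 0 < n → 3 ≤ n → ∀ (ℓ : ℕ) [Fact ℓ.Prime] (ι : PadicAlgCl ℓ ≃+* ℂ) (ρ : Literature.NumberTheory.GaloisRepresentations.FramedGaloisRep K (PadicAlgCl ℓ) n), ρ.toGaloisRep.IsIrreducible → ((∀ᶠ v : IsDedekindDomain.HeightOneSpectrum (NumberField.RingOfIntegers K) in cofinite, ρ.IsUnramifiedAt v) ∧ ∀ (v : IsDedekindDomain.HeightOneSpectrum (NumberField.RingOfIntegers K)) (hv : ((ℓ : ℕ) : NumberField.RingOfIntegers K) ∈ v.asIdeal), (Literature.NumberTheory.PAdicHodge.fontainePstAdicCompletion v ℓ hv).IsDeRhamFramed (ρ.toLocal v)) → Summit.Langlands.Langlands.Theorems.WeightMultiplicitySplitMinusculeHodgeType.IsWallHT ρ → (∃ S : Set (IsDedekindDomain.HeightOneSpectrum (NumberField.RingOfIntegers K)), S.Finite ∧ ∀ r : NNReal, 0 < r → ∃ π : Literature.NumberTheory.Automorphic.CuspidalAutomorphicRepData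 n K hcpt, π.1.IsLAlgebraic ∧ ∀ v : IsDedekindDomain.HeightOneSpectrum (NumberField.RingOfIntegers K), v ∉ S → (∃ α : Multiset ℂ, π.1.HasSatakeParamAt v α ∧ ∀ 𝔓 ∈ v.primesAbove, ∀ σ : Field.absoluteGaloisGroup K, IsArithFrobAt (NumberField.RingOfIntegers K) σ 𝔓 → ∀ i : ℕ, Valued.v ((Literature.NumberTheory.GaloisRepresentations.FramedRep.charpoly ρ σ - Literature.NumberTheory.Automorphic.arithFrobPolyOfSatake ι v.residueCard 1 α).coeff i) < r)) → ∃ π : Literature.NumberTheory.Automorphic.CuspidalAutomorphicRepData n K hcpt, π.1.IsLAlgebraic ∧ ∀ᶠ v : IsDedekindDomain.HeightOneSpectrum (NumberField.RingOfIntegers K) in cofinite, SatakeFrobCompatibleAt ι π.1 ρ v := by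
  sorry

namespace _Goal

/-- the statement of `stub_wallRankTwoOdd` as a named Prop. -/
def stub_wallRankTwoOdd : Prop :=
  type_of% @Summit.Langlands.Langlands.Cruxes.WallClassicality.Birth.stub_wallRankTwoOdd

/-- the statement of `stub_wallRankTwoNonOdd` as a named Prop. -/
def stub_wallRankTwoNonOdd : Prop :=
  type_of% @Summit.Langlands.Langlands.Cruxes.WallClassicality.Birth.stub_wallRankTwoNonOdd

/-- the statement of `stub_wallRankGeThree` as a named Prop. -/
def stub_wallRankGeThree : Prop :=
  type_of% @Summit.Langlands.Langlands.Cruxes.WallClassicality.Birth.stub_wallRankGeThree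

end _Goal

/-- **`WallClassicality` from the three stubs** (kernel-checked, no sorry): the hypotheses are, by name, the statements of the stubs; the conclusion is the route decl `Summit.Langlands.Langlands.Theses.ClassicalityWeightSplit.WallClassicality`; seam = `omega` on the rank; the rank ≤ 1 chamber is discharged INSIDE the composition by the rank bound — it is empty — and rank 2 splits by excluded middle on PARITY `ρ.IsOdd`. -/
theorem WallClassicality_of (h1 : _Goal.stub_wallRankTwoOdd) (h2 : _Goal.stub_wallRankTwoNonOdd) (h3 : _Goal.stub_wallRankGeThree) :
    Summit.Langlands.Langlands.Theses.ClassicalityWeightSplit.WallClassicality := by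
  have ha : type_of% @stub_wallRankTwoOdd := h1
  have hb : type_of% @stub_wallRankTwoNonOdd := h2
  have hc : type_of% @stub_wallRankGeThree := h3
  intro K _ _ n hcpt hn ℓ _ ι ρ hirr hgeo hw hpro
  rcases Nat.lt_or_ge n 3 with hlt | hge
  · rcases Nat.lt_or_ge n 2 with hlt2 | hge2
    · exact (hw.1 (hodgeTateMultLE_of_rank_le hgeo.2 (by omega))).elim
    · exact Classical.byCases (fun hodd => ha K n hcpt hn (by omega) ℓ ι ρ hirr hgeo hw hodd hpro)
        (fun hodd => hb K n hcpt hn (by omega) ℓ ι ρ hirr hgeo hw hodd hpro)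
  · exact hc K n hcpt hn hge ℓ ι ρ hirr hgeo hw hpro

/-- By-name sanity check (an `example`, not a declaration of the file): the stubs feed the composition as they stand. -/
example : Summit.Langlands.Langlands.Theses.ClassicalityWeightSplit.WallClassicality :=
  WallClassicality_of stub_wallRankTwoOdd stub_wallRankTwoNonOdd stub_wallRankGeThree

/-- Hypothesis-free assembly (operator recipe 2026-08-30T22:10Z for `skeleton check`: a theorem concluding the crux BY NAME, assembled from the
sorried `stub_*` theorems — it inherits their `sorry`, nothing else). -/
theorem WallClassicality_proof : Summit.Langlands.Langlands.Theses.ClassicalityWeightSplit.WallClassicality :=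
  WallClassicality_of stub_wallRankTwoOdd stub_wallRankTwoNonOdd stub_wallRankGeThree

end Summit.Langlands.Langlands.Cruxes.WallClassicality.Birth
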